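import Literature.AlgebraicGeometry.HodgeTheory.LefschetzPowerPolarisation
import Literature.AlgebraicGeometry.HodgeTheory.TopHodgeClassesSpannedByPullbacksFact
import Literature.AlgebraicGeometry.HodgeTheory.HolomorphicBundleChernCharacterTopDegree
import Literature.AlgebraicGeometry.HodgeTheory.ChernCharacterClass
import Literature.AlgebraicGeometry.HodgeTheory.HodgeTypePullbackVanishing
import Literature.AlgebraicGeometry.HodgeTheory.HardLefschetzNFoldHolds
import Literature.AlgebraicGeometry.HodgeTheory.HyperplaneClassLine
import Literature.AlgebraicGeometry.HodgeTheory.HyperplaneClassPullback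
import Literature.AlgebraicGeometry.HodgeTheory.GlobalInvariantCyclesProofs
import Literature.AlgebraicGeometry.Motives.ProjectiveNoetherNormalization
import Literature.AlgebraicGeometry.Motives.FiniteProjectionExists
import Literature.AlgebraicGeometry.Motives.SegreHyperplaneClass
import Literature.Geometry.Kaehler.ChernCharacterPullback
import Literature.Topology.FourManifolds.ComplexProjectiveSpaceCohomology
import HarnessLib

/-!
# The rational `(d,d)`-classes of a `(d+1)`-fold are spanned by pull-backs from `ℙ^{d+1}` — assembly
# from five inputs (Chern-character functoriality, linear-equivalence transport, projective Noether
# normalisation, Segre additivity, Lefschetz `(1,1)` in embedding currency)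

Family `hodge`, layer `Literature/AlgebraicGeometry/HodgeTheory`. Assembly of the named fact
`topHodgeClasses_spanned_by_pullbacks` (`HodgeTheory/TopHodgeClassesSpannedByPullbacksFact`) from five
statements about the first Chern character `c_Φ := ch₁(𝒪(-1)|_T) ∈ H²(T(ℂ); ℂ)` of the tautological
cocycle of a closed immersion `Φ : T ⟶ ℙᴷ` read on a Hodge model (`Motives.AnalytificationKaehler.tautologicalBundle`,
`HodgeModel.chernCharacter`): (A) functoriality along an arbitrary morphism up to one scalar
(PROVED in the tree: `HodgeModel.exists_chernCharacter_tautologicalBundle_pullback_eq_smul_map`,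
`HodgeTheory/ChernCharacterTautologicalPullback`), (C) transport of linear equivalence of hyperplane
divisors, (E1) projective Noether normalisation keeping `ψ^*H ∼ m•D_Ψ`, (P1) Segre additivity,
(G4) Lefschetz `(1,1)` in embedding currency. The proof: hard Lefschetz
(`HardLefschetzNFold.exists_hdg_preimage`) writes a rational `(d,d)`-class as `h^{d-1} ∪ y`, `y` rational
of type `(1,1)`, with `h ∝ c_ι` ((A) on the embedding `ι`, `tautologicalBundle_pullback_anMap`); (G4)
expands `y` in the `c_Φ`; the monomials `c_ι^{d-1} c_Φ` are polarised into `d`-th Lefschetz powers of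
`c_ι + t c_Φ = c_{Ψ_t}` ((P1) along a Segre iteration; `HodgeTheory/LefschetzPowerPolarisation`), and
`c_{Ψ_t}^d ∝ ψ_t^*(u)` for the Noether map `ψ_t : T ⟶ ℙ^{d+1}` of `Ψ_t` ((E1), (C), (A)); for curves
`H⁰ = ℂ · 1 = ℂ · F^*1`. Everything here is proved; the five inputs are hypotheses of the final theorem
`topHodgeClasses_spanned_by_pullbacks_of_inputs`.

## References

* [VoisinHodgeI2002] C. Voisin, Hodge Theory and Complex Algebraic Geometry I, CUP 2002, Thm. 6.25,
  Thm. 7.10, Thm. 11.30, §11.3.3.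
* [Hartshorne1977] R. Hartshorne, Algebraic Geometry, GTM 52, II Cor. 4.2, II Ex. 4.8, II Thm. 7.1,
  II Ex. 5.11–5.12.
* [GortzWedhorn2020] U. Görtz, T. Wedhorn, Algebraic Geometry I, 2nd ed., Thm. 13.89.
* [HatcherAT2002] A. Hatcher, Algebraic Topology, CUP 2002, Prop. 3.10, Thm. 3.11, §3.1–3.2.
* [Kobayashi1987] S. Kobayashi, Differential Geometry of Complex Vector Bundles, Ch. I §1 (1.20).
-/

noncomputable section

open scoped Manifold ContDiff
open CategoryTheory AlgebraicGeometry MonoidalCategory CartesianMonoidalCategory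
open Literature.AlgebraicGeometry Literature.AlgebraicGeometry.Motives
open Literature.AlgebraicGeometry.Motives.AnalytificationKaehler (tautologicalBundle chartDom coordFun)
open Literature.AlgebraicTopology.SingularHomology Literature.Geometry.Kaehler
open Literature.NumberTheory.Transcendental

namespace Literature.AlgebraicGeometry.HodgeTheory

section HodgeTheory

variable {T : Motives.SchemeOver ℂ}

/-! ### The tautological cocycle of `ι ≫ κ` is the pull-back of that of `κ` along `ι^an` -/

omit T in
/-- Two smooth cocycles with the same trivialising sets and the same transition matrices are equal.
[folklore] -/
theorem _root_.Literature.Geometry.Kaehler.SmoothComplexVectorBundle.ext' {ι E : Type*} [NormedAddCommGroup E]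
    [NormedSpace ℂ E] {M : Type*} [TopologicalSpace M] [ChartedSpace E M] {r : ℕ}
    {V W : SmoothComplexVectorBundle ι E M r} (h₁ : V.baseSet = W.baseSet)
    (h₂ : V.coordChange = W.coordChange) : V = W := by
  cases V; cases W; cases h₁; cases h₂; rfl

/-- **`(ι^an)⁻¹ 𝒪_{Y}(-1) = 𝒪_X(-1)` as cocycles**: for Hodge models `A` of `X`, `B` of `Y` (smooth
projective), a morphism `ι : X ⟶ Y` and a closed immersion `κ : Y ⟶ ℙᴺ` with `ι ≫ κ` a closed immersion,
the pull-back along `ι^an = anMap B A ι` of the tautological cocycle of `κ` IS the tautological cocycle of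
`ι ≫ κ` (same charts `φ⁻¹(ι ≫ κ)⁻¹D₊(xⱼ)`, same transition functions `(ι ≫ κ)^*(xᵢ/xⱼ)`).
[cite: Kobayashi1987, Ch. I §1 (1.20)] [cite: Hartshorne1977, II Thm. 7.1 (a)] -/
theorem tautologicalBundle_pullback_anMap {n m N : ℕ} {X Y : Motives.SchemeOver ℂ} (A : HodgeModel n X)
    (B : HodgeModel m Y) (ι : X ⟶ Y) (κ : Y ⟶ Motives.projectiveSpace N ℂ) [IsClosedImmersion κ.left]
    [IsClosedImmersion (ι ≫ κ).left] (hX : Motives.IsSmoothProjective n X) (hY : Motives.IsSmoothProjective m Y) :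
    (tautologicalBundle κ B.isAnalytification).pullback (HodgeModel.anMap B A ι)
        (HodgeModel.contMDiff_anMap B A ι hX hY) = tautologicalBundle (ι ≫ κ) A.isAnalytification := by
  refine SmoothComplexVectorBundle.ext' ?_ ?_
  · funext j
    ext x
    exact (AnalytificationKaehler.mem_chartDom_comp_iff ι κ (HodgeModel.toComplexPoints_anMap B A ι) j x).symm
  · funext i j x
    ext a b
    simp only [SmoothComplexVectorBundle.pullback_coordChange, Function.comp_apply,
      AnalytificationKaehler.tautologicalBundle_coordChange_apply]
    have h := AnalytificationKaehler.coordVec_comp ι κ (HodgeModel.toComplexPoints_anMap B A ι) j x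
    have h' := congrArg (fun v : EuclideanSpace ℂ (Fin (N + 1)) ↦ v i) h
    simpa only [AnalytificationKaehler.coordVec_apply] using h'.symm

/-! ### The Segre iteration `Ψ₀ = ι`, `Ψ_{t+1} = σ ∘ (Ψ_t, Φ)`: closed immersions with `c = c_ι + t c_Φ` -/

/-- The graph-type morphism `(Φ, G) : T ⟶ X ⊗ Y` is a closed immersion as soon as `Φ` is one and `Y` is
separated over `ℂ`. [cite: Hartshorne1977, II Cor. 4.2 and Ex. 4.8] -/
theorem isClosedImmersion_lift_left_of_left {X Y : Motives.SchemeOver ℂ} (Φ : T ⟶ X) [IsClosedImmersion Φ.left]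
    (G : T ⟶ Y) [IsSeparated Y.hom] : IsClosedImmersion (lift Φ G).left := by
  have h : (lift Φ G).left ≫ (fst X Y).left = Φ.left := by
    rw [← Over.comp_left, lift_fst]
  haveI : IsSeparated (fst X Y).left := inferInstanceAs (IsSeparated (Limits.pullback.fst X.hom Y.hom))
  haveI : IsClosedImmersion ((lift Φ G).left ≫ (fst X Y).left) := by
    rw [h]; infer_instance
  exact IsClosedImmersion.of_comp _ (fst X Y).left

/-- **Segre iteration.** Granted Segre additivity of `c` (input (P1)): for closed immersions
`ι : T ⟶ ℙᴺ`, `Φ : T ⟶ ℙᴷ` and every `t ∈ ℕ` there is a closed immersion `Ψ : T ⟶ ℙᴸ` with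
`c_Ψ = c_ι + t • c_Φ`. [cite: Hartshorne1977, II Ex. 5.11 and Ex. 5.12] -/
theorem exists_isClosedImmersion_chernCharacter_eq_add_nsmul {n N K : ℕ} (hT : Motives.IsSmoothProjective n T)
    (A : HodgeModel n T)
    (hP : ∀ ⦃n K₁ K₂ : ℕ⦄ ⦃T : Motives.SchemeOver ℂ⦄ (_hT : Motives.IsSmoothProjective n T) (A : HodgeModel n T)
      (Φ₁ : T ⟶ Motives.projectiveSpace K₁ ℂ) [IsClosedImmersion Φ₁.left]
      (Φ₂ : T ⟶ Motives.projectiveSpace K₂ ℂ) [IsClosedImmersion Φ₂.left]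
      [IsClosedImmersion (CartesianMonoidalCategory.lift Φ₁ Φ₂ ≫ Motives.segreEmbedding K₁ K₂ ℂ).left],
      A.chernCharacter (Motives.AnalytificationKaehler.tautologicalBundle
          (CartesianMonoidalCategory.lift Φ₁ Φ₂ ≫ Motives.segreEmbedding K₁ K₂ ℂ) A.isAnalytification) 1 =
        A.chernCharacter (Motives.AnalytificationKaehler.tautologicalBundle Φ₁ A.isAnalytification) 1 +
          A.chernCharacter (Motives.AnalytificationKaehler.tautologicalBundle Φ₂ A.isAnalytification) 1)
    (ι : T ⟶ Motives.projectiveSpace N ℂ) [IsClosedImmersion ι.left]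
    (Φ : T ⟶ Motives.projectiveSpace K ℂ) [IsClosedImmersion Φ.left] :
    ∀ t : ℕ, ∃ (L : ℕ) (Ψ : T ⟶ Motives.projectiveSpace L ℂ) (_ : IsClosedImmersion Ψ.left),
      A.chernCharacter (tautologicalBundle Ψ A.isAnalytification) 1 =
        A.chernCharacter (tautologicalBundle ι A.isAnalytification) 1 +
          (t : ℂ) • A.chernCharacter (tautologicalBundle Φ A.isAnalytification) 1
  | 0 => ⟨N, ι, inferInstance, by rw [Nat.cast_zero, zero_smul, add_zero]⟩
  | t + 1 => by
    obtain ⟨L, Ψ, hΨ, hc⟩ := exists_isClosedImmersion_chernCharacter_eq_add_nsmul hT A hP ι Φ t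
    haveI := hΨ
    haveI := SegreHyperplaneClass.isSeparated_projectiveSpace_hom K
    haveI := isClosedImmersion_lift_left_of_left Ψ Φ
    haveI : IsClosedImmersion (lift Ψ Φ ≫ Motives.segreEmbedding L K ℂ).left := by
      rw [Over.comp_left]
      infer_instance
    refine ⟨L * K + L + K, lift Ψ Φ ≫ Motives.segreEmbedding L K ℂ, inferInstance, ?_⟩
    rw [hP hT A Ψ Φ, hc, Nat.cast_succ, add_smul, one_smul, add_assoc]

/-! ### The assembly -/

/-- `F^* 1 = 1` for the pull-back in singular cohomology of complex points. [cite: HatcherAT2002, Prop. 3.10] -/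
theorem complexBetti_map_one {X Y : Motives.SchemeOver ℂ} (F : X ⟶ Y) :
    complexBetti.map F 0 (singularCohomology.one ℂ (Motives.ComplexPoints Y)) =
      singularCohomology.one ℂ (Motives.ComplexPoints X) :=
  singularCohomology.map_one _

/-- **The spanning fact from the five inputs.** For `T` smooth projective of dimension `d + 1`, every
rational `(d,d)`-class in `H^{2d}(T(ℂ); ℂ)` is a `ℂ`-combination of pull-backs `F^*u`, `F : T ⟶ ℙ^{d+1}`,
granted: (A) functoriality of `ch₁(𝒪(-1))` along arbitrary morphisms up to one scalar, (C) transport of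
linear equivalence of hyperplane divisors to `ch₁`, (E1) projective Noether normalisation with
linear-equivalence control, (P1) Segre additivity of `ch₁(𝒪(-1))`, (G4) Lefschetz `(1,1)` in embedding
currency. Proof: hard Lefschetz with surjectivity on rational Hodge classes
(`HardLefschetzNFold.exists_hdg_preimage`), `h ∝ c_ι` ((A) on the embedding), polarisation of
`c_ι^{d-1} c_Φ` (binomial theorem + Vandermonde), Segre iteration ((P1)), and `c_Ψ^d ∝ ψ^*(u)` for the
Noether map of `Ψ` ((E1), (C), (A)); `d = 0`: `H⁰ = ℂ · 1 = ℂ · F^*1`.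
[cite: VoisinHodgeI2002, Thm. 6.25, Thm. 7.10 and Thm. 11.30] [cite: GortzWedhorn2020, Thm. 13.89]
[cite: Hartshorne1977, II Ex. 5.11 and Ex. 5.12] -/
theorem topHodgeClasses_spanned_by_pullbacks_of_inputs
    (hA :
      ∀ ⦃n N : ℕ⦄ ⦃T : Motives.SchemeOver ℂ⦄ (hT : Motives.IsSmoothProjective n T) (A : HodgeModel n T)
        (B : HodgeModel N (Motives.projectiveSpace N ℂ))
        [IsClosedImmersion (𝟙 (Motives.projectiveSpace N ℂ) : Motives.projectiveSpace N ℂ ⟶ _).left], n ≤ N →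
        ∃ r : ℂ, r ≠ 0 ∧ ∀ ψ : T ⟶ Motives.projectiveSpace N ℂ,
          A.chernCharacter
            ((Motives.AnalytificationKaehler.tautologicalBundle (𝟙 (Motives.projectiveSpace N ℂ)) B.isAnalytification).pullback
              (HodgeModel.anMap B A ψ)
              (HodgeModel.contMDiff_anMap B A ψ hT (isSmoothProjective_projectiveSpace' N))) 1 =
          r • complexBetti.map ψ (2 * 1)
            (B.chernCharacter
              (Motives.AnalytificationKaehler.tautologicalBundle (𝟙 (Motives.projectiveSpace N ℂ)) B.isAnalytification) 1) )
    (hC :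
      ∀ ⦃n N K : ℕ⦄ ⦃T : Motives.SchemeOver ℂ⦄ [IsIntegral T.left] (hT : Motives.IsSmoothProjective n T)
        (A : HodgeModel n T) (B : HodgeModel N (Motives.projectiveSpace N ℂ))
        [IsClosedImmersion (𝟙 (Motives.projectiveSpace N ℂ) : Motives.projectiveSpace N ℂ ⟶ _).left]
        (Ψ : T ⟶ Motives.projectiveSpace K ℂ) [IsClosedImmersion Ψ.left]
        (ψ : T ⟶ Motives.projectiveSpace N ℂ) (hψ : IsDominant ψ.left) (j₀ : Fin (K + 1))
        (hj₀ : genericPoint T.left ∈ (Motives.GeneratingSections.ofHom Ψ.left).U j₀) (m : ℕ),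
        (@Motives.CartierDivisor.pullback _ _ (Motives.ProjSpace.hyperplane N ℂ) T.left _ ψ.left hψ).LinEquiv
            (m • (Motives.GeneratingSections.ofHom Ψ.left).divisor j₀ hj₀) →
        A.chernCharacter
            ((Motives.AnalytificationKaehler.tautologicalBundle (𝟙 (Motives.projectiveSpace N ℂ)) B.isAnalytification).pullback
              (HodgeModel.anMap B A ψ)
              (HodgeModel.contMDiff_anMap B A ψ hT (isSmoothProjective_projectiveSpace' N))) 1 =
          (m : ℂ) • A.chernCharacter (Motives.AnalytificationKaehler.tautologicalBundle Ψ A.isAnalytification) 1 )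
    (hE :
      ∀ ⦃d K : ℕ⦄ ⦃T : Motives.SchemeOver ℂ⦄ [IsIntegral T.left] (hT : Motives.IsSmoothProjective (d + 1) T)
        (Ψ : T ⟶ Motives.projectiveSpace K ℂ) [IsClosedImmersion Ψ.left] (j₀ : Fin (K + 1))
        (hj₀ : genericPoint T.left ∈ (Motives.GeneratingSections.ofHom Ψ.left).U j₀),
        ∃ (ψ : T ⟶ Motives.projectiveSpace (d + 1) ℂ) (m : ℕ) (hψ : IsDominant ψ.left), 0 < m ∧
          IsFinite ψ.left ∧ Surjective ψ.left ∧
          (@Motives.CartierDivisor.pullback _ _ (Motives.ProjSpace.hyperplane (d + 1) ℂ) T.left _ ψ.left hψ).LinEquiv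
            (m • (Motives.GeneratingSections.ofHom Ψ.left).divisor j₀ hj₀) )
    (hP :
      ∀ ⦃n K₁ K₂ : ℕ⦄ ⦃T : Motives.SchemeOver ℂ⦄ (_hT : Motives.IsSmoothProjective n T) (A : HodgeModel n T)
        (Φ₁ : T ⟶ Motives.projectiveSpace K₁ ℂ) [IsClosedImmersion Φ₁.left]
        (Φ₂ : T ⟶ Motives.projectiveSpace K₂ ℂ) [IsClosedImmersion Φ₂.left]
        [IsClosedImmersion (CartesianMonoidalCategory.lift Φ₁ Φ₂ ≫ Motives.segreEmbedding K₁ K₂ ℂ).left],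
        A.chernCharacter (Motives.AnalytificationKaehler.tautologicalBundle
            (CartesianMonoidalCategory.lift Φ₁ Φ₂ ≫ Motives.segreEmbedding K₁ K₂ ℂ) A.isAnalytification) 1 =
          A.chernCharacter (Motives.AnalytificationKaehler.tautologicalBundle Φ₁ A.isAnalytification) 1 +
            A.chernCharacter (Motives.AnalytificationKaehler.tautologicalBundle Φ₂ A.isAnalytification) 1 )
    (hG :
      ∀ ⦃n : ℕ⦄ ⦃T : Motives.SchemeOver ℂ⦄ (_hT : Motives.IsSmoothProjective n T) (A : HodgeModel n T), 1 ≤ n →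
        ∀ y : complexBetti T (2 * 1), IsRationalClass y → IsOfHodgeType n T (2 * 1) 1 1 y →
          y ∈ Submodule.span ℂ {c : complexBetti T (2 * 1) |
            ∃ (K : ℕ) (Φ : T ⟶ Motives.projectiveSpace K ℂ) (_ : IsClosedImmersion Φ.left),
              c = A.chernCharacter (Motives.AnalytificationKaehler.tautologicalBundle Φ A.isAnalytification) 1} ) :
    topHodgeClasses_spanned_by_pullbacks := by
  intro d T hT a ha hdd
  haveI : IsIntegral T.left := Motives.IsSmoothProjective.isIntegral_holds hT
  -- the case of curves: `H⁰ = ℂ · 1 = ℂ · F^* 1`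
  rcases Nat.eq_zero_or_pos d with rfl | hd
  · haveI := pathConnectedSpace_complexPoints hT
    obtain ⟨c, hc⟩ := Literature.Topology.FourManifolds.ComplexProjectiveSpace.exists_eq_smul_one (K := ℂ) a
    obtain ⟨F, -, -⟩ := hT.exists_isFinite_surjective_hom (k := ℂ)
    rw [hc]
    refine Submodule.smul_mem _ c (Submodule.subset_span ⟨F, singularCohomology.one ℂ _, ?_⟩)
    exact (complexBetti_map_one F).symm
  -- an embedding `ι = ι₀ ≫ 𝟙 : T ⟶ ℙᴺ`, Hodge models `A` of `T`, `B` of `ℙᴺ`, `B'` of `ℙ^{d+1}`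
  obtain ⟨N, ι₀, hι₀⟩ := hT.isProjectiveOver
  haveI := hι₀
  have hPN : Motives.IsSmoothProjective N (Motives.projectiveSpace N ℂ) := isSmoothProjective_projectiveSpace' N
  have hP' : Motives.IsSmoothProjective (d + 1) (Motives.projectiveSpace (d + 1) ℂ) :=
    isSmoothProjective_projectiveSpace' (d + 1)
  haveI hid : IsClosedImmersion (𝟙 (Motives.projectiveSpace N ℂ) : Motives.projectiveSpace N ℂ ⟶ _).left :=
    show IsClosedImmersion (𝟙 (Motives.projectiveSpace N ℂ).left) from inferInstance
  haveI hid' : IsClosedImmersion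
      (𝟙 (Motives.projectiveSpace (d + 1) ℂ) : Motives.projectiveSpace (d + 1) ℂ ⟶ _).left :=
    show IsClosedImmersion (𝟙 (Motives.projectiveSpace (d + 1) ℂ).left) from inferInstance
  haveI hιc : IsClosedImmersion (ι₀ ≫ 𝟙 (Motives.projectiveSpace N ℂ)).left := by
    rw [Over.comp_left]; infer_instance
  have hnN : d + 1 ≤ N := le_of_isClosedImmersion_projectiveSpace hT ι₀
  obtain ⟨A⟩ := (nonempty_hodgeModel_holds (n := d + 1) (X := T)).nonempty hT
  obtain ⟨B⟩ := (nonempty_hodgeModel_holds (n := N) (X := Motives.projectiveSpace N ℂ)).nonempty hPN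
  obtain ⟨B'⟩ := (nonempty_hodgeModel_holds (n := d + 1) (X := Motives.projectiveSpace (d + 1) ℂ)).nonempty hP'
  -- the pulled-back tautological cocycle of `ι₀` is the tautological cocycle of `ι`
  have hpb := tautologicalBundle_pullback_anMap A B ι₀ (𝟙 (Motives.projectiveSpace N ℂ)) hT hPN
  set ι : T ⟶ Motives.projectiveSpace N ℂ := ι₀ ≫ 𝟙 (Motives.projectiveSpace N ℂ) with hιdef
  have hmapι : ∀ (k : ℕ) (x : complexBetti (Motives.projectiveSpace N ℂ) k),
      complexBetti.map ι k x = complexBetti.map ι₀ k x := fun k x ↦ by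
    rw [hιdef, SegreHyperplaneClass.map_comp_apply', complexBetti.map_id]
    rfl
  -- the currency
  set cι : complexBetti T (2 * 1) := A.chernCharacter (tautologicalBundle ι A.isAnalytification) 1 with hcιdef
  set cB : complexBetti (Motives.projectiveSpace N ℂ) (2 * 1) :=
    B.chernCharacter (tautologicalBundle (𝟙 (Motives.projectiveSpace N ℂ)) B.isAnalytification) 1 with hcBdef
  set cB' : complexBetti (Motives.projectiveSpace (d + 1) ℂ) (2 * 1) :=
    B'.chernCharacter (tautologicalBundle (𝟙 (Motives.projectiveSpace (d + 1) ℂ)) B'.isAnalytification) 1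
    with hcB'def
  -- (1) the hyperplane-type class `H` of `ι`, a hard Lefschetz datum `Λ` with `Λ.h = w • H`
  obtain ⟨e, he, hem, -⟩ := exists_deRhamIsoFamily_holds A.model
  have hθ := A.fubiniStudyPullbackForm_mem_closedSmoothForms ι
  obtain ⟨H, hH⟩ := A.pullback_surjective 2 (ofRealClass A.carrier 2
    (e A.carrier 2 (deRhamCohomology.mk
      ⟨Motives.AnalytificationKaehler.fubiniStudyPullbackForm A.model ι A.toComplexPoints, hθ⟩)))
  obtain ⟨w, hw, hrat⟩ := exists_ne_zero_smul_isRationalClass_of_pullback_eq_fubiniStudy hT A ι e he hθ hH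
  obtain ⟨Λ, hΛ⟩ := A.exists_hardLefschetzNFold_of_pullback_eq_fubiniStudy_smul ι e hT he hem hθ hH hw hrat
  -- (2) `cB ≠ 0`, `ι^* cB = s • H` with `s ≠ 0`, and `cι = r • ι^* cB` by (A): `Λ.h = κ • cι`
  have hcB : cB ≠ 0 := by
    obtain ⟨c, hc, hc0⟩ := HodgeModel.exists_mem_chernCharacterSet_tautologicalBundle_ne_zero
      (𝟙 (Motives.projectiveSpace N ℂ)) B hPN (p := 1) (by omega)
    rwa [hcBdef, B.chernCharacter_eq_of_mem hc]
  obtain ⟨s, hs, hs0⟩ := exists_map_eq_smul_of_pullback_eq_fubiniStudy hT A ι e he hθ hH cB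
  have hs0' : s ≠ 0 := hs0 (by omega) hcB
  obtain ⟨r, hr, hrψ⟩ := hA hT A B hnN
  have hcι : cι = (r * s) • H := by
    have h1 := hrψ ι₀
    rw [hpb] at h1
    rw [hcιdef, h1, ← hmapι, hs, smul_smul]
  have hκ : Λ.hyperplaneClass = (w * (r * s)⁻¹) • cι := by
    rw [hΛ, hcι, smul_smul, mul_assoc, inv_mul_cancel₀ (mul_ne_zero hr hs0'), mul_one w]
  -- (3) hard Lefschetz: `a = L^{d-1}_{Λ.h} y`, `y` rational of type `(1,1)`
  have hdd' : IsOfHodgeType (d + 1) T (2 * d) (1 + (d - 1)) (1 + (d - 1)) a := by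
    rw [show 1 + (d - 1) = d by omega]; exact hdd
  obtain ⟨y, hy, hy11, hLy⟩ := Λ.exists_hdg_preimage (j := d - 1) (k := 2) (by omega) (2 * d)
    (by omega : 2 + 2 * (d - 1) = 2 * d) 1 1 a ha hdd'
  -- the target submodule
  set W : Submodule ℂ (complexBetti T (2 * d)) := Submodule.span ℂ {b : complexBetti T (2 * d) |
    ∃ (F : T ⟶ Motives.projectiveSpace (d + 1) ℂ) (u : complexBetti (Motives.projectiveSpace (d + 1) ℂ) (2 * d)),
      b = complexBetti.map F (2 * d) u} with hWdef
  change a ∈ W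
  -- (4) each monomial `L^{d-1}_{cι} c_Φ` lies in `W`
  have hmono : ∀ {K : ℕ} (Φ : T ⟶ Motives.projectiveSpace K ℂ) [IsClosedImmersion Φ.left],
      lefschetzPowTo cι (d - 1) 2 (2 * d) (by omega) (A.chernCharacter (tautologicalBundle Φ A.isAnalytification) 1)
        ∈ W := by
    intro K Φ _
    rw [lefschetzPowTo_eq_degCast_cupProduct cι _ (by omega : 2 + 2 * (d - 1) = 2 * d)]
    -- polarisation: the monomial is a combination of the powers `L^d_{cι + t c_Φ}(1)`
    have hpol := cupProduct_lefschetzPow_one_one_mem_span cι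
      (A.chernCharacter (tautologicalBundle Φ A.isAnalytification) 1) d ⟨1, by omega⟩
    have hdite : (d - ((⟨1, by omega⟩ : Fin (d + 1)) : ℕ), ((⟨1, by omega⟩ : Fin (d + 1)) : ℕ)).1 +
        (d - ((⟨1, by omega⟩ : Fin (d + 1)) : ℕ), ((⟨1, by omega⟩ : Fin (d + 1)) : ℕ)).2 = d := by
      dsimp only; omega
    simp only [dif_pos hdite] at hpol
    have hle : Submodule.map (complexBetti.degCast T (Nat.zero_add (2 * d))).toLinearMap
        (Submodule.span ℂ (Set.range fun t : Fin (d + 1) ↦ lefschetzPow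
          (cι + ((t : ℕ) : ℂ) • A.chernCharacter (tautologicalBundle Φ A.isAnalytification) 1) d 0
            (singularCohomology.one ℂ (Motives.ComplexPoints T)))) ≤ W := by
      rw [Submodule.map_span, Submodule.span_le]
      rintro _ ⟨_, ⟨t, rfl⟩, rfl⟩
      -- the Segre iterate `Ψ` with `c_Ψ = cι + t • c_Φ`, its Noether map `ψ`
      obtain ⟨L, Ψ, hΨ, hcΨ⟩ := exists_isClosedImmersion_chernCharacter_eq_add_nsmul hT A hP ι Φ (t : ℕ)
      haveI := hΨ
      obtain ⟨j₀, hj₀⟩ := (Motives.GeneratingSections.ofHom Ψ.left).exists_mem_U (genericPoint T.left)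
      obtain ⟨ψ, m, hψ, hm, -, -, hlin⟩ := hE hT Ψ j₀ hj₀
      have hCψ := hC hT A B' Ψ ψ hψ j₀ hj₀ m hlin
      obtain ⟨r', hr', hr'ψ⟩ := hA hT A B' le_rfl
      have hcΨ' : A.chernCharacter (tautologicalBundle Ψ A.isAnalytification) 1 =
          ((m : ℂ)⁻¹ * (r' : ℂ)) • complexBetti.map ψ (2 * 1) cB' := by
        have hm0 : (m : ℂ) ≠ 0 := by exact_mod_cast hm.ne'
        have h2 := hr'ψ ψ
        rw [hCψ] at h2
        rw [← smul_smul, ← h2, smul_smul, inv_mul_cancel₀ hm0, one_smul]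
      change (complexBetti.degCast T (Nat.zero_add (2 * d))) (lefschetzPow
        (cι + ((t : ℕ) : ℂ) • A.chernCharacter (tautologicalBundle Φ A.isAnalytification) 1) d 0
          (singularCohomology.one ℂ (Motives.ComplexPoints T))) ∈ W
      rw [← hcΨ, hcΨ', lefschetzPow_smul, LinearEquiv.map_smul]
      refine Submodule.smul_mem _ _ (Submodule.subset_span ⟨ψ,
        complexBetti.degCast (Motives.projectiveSpace (d + 1) ℂ) (Nat.zero_add (2 * d))
          (lefschetzPow cB' d 0 (singularCohomology.one ℂ (Motives.ComplexPoints (Motives.projectiveSpace (d + 1) ℂ)))), ?_⟩)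
      rw [map_degCast, lefschetzPow_map, complexBetti_map_one]
    exact hle (Submodule.mem_map_of_mem hpol)
  -- (5) `y` is a combination of the `c_Φ` (G4), so `L^{d-1}_{cι} y ∈ W`, and `a = κ^{d-1} • L^{d-1}_{cι} y`
  have hyspan := hG hT A (by omega) y hy hy11
  have hLy' : lefschetzPowTo cι (d - 1) 2 (2 * d) (by omega) y ∈ W := by
    have hle : Submodule.map (lefschetzPowTo cι (d - 1) 2 (2 * d) (by omega : 2 + 2 * (d - 1) = 2 * d))
        (Submodule.span ℂ {c : complexBetti T (2 * 1) |
          ∃ (K : ℕ) (Φ : T ⟶ Motives.projectiveSpace K ℂ) (_ : IsClosedImmersion Φ.left),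
            c = A.chernCharacter (Motives.AnalytificationKaehler.tautologicalBundle Φ A.isAnalytification) 1}) ≤ W := by
      rw [Submodule.map_span, Submodule.span_le]
      rintro _ ⟨_, ⟨K, Φ, hΦ, rfl⟩, rfl⟩
      haveI := hΦ
      exact hmono Φ
    exact hle (Submodule.mem_map_of_mem hyspan)
  rw [← hLy]
  change lefschetzPowTo Λ.hyperplaneClass (d - 1) 2 (2 * d) _ y ∈ W
  rw [hκ, lefschetzPowTo_smul]
  exact Submodule.smul_mem _ _ hLy'

end HodgeTheory

end Literature.AlgebraicGeometry.HodgeTheory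

end
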